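import Summits.MatrixMultiplication.OmegaCensus.STPPSmallPatternT2K14W284Law
import Summits.MatrixMultiplication.OmegaCensus.STPPSmallPatternT2K15W316Law
import Summits.MatrixMultiplication.OmegaCensus.STPPSmallPatternT2K16W324Law
import Summits.MatrixMultiplication.OmegaCensus.STPPSmallPatternEvenOrderLift

/-!
# ω-census, `(2,2,2)^k` from the WINDOW laws `k = 14, 15, 16`: even orders down to twice the ray start

HONEST FRAMING (pub-omega census; verbatim): lottery ticket; floor = certified bounds/negative ranges.
Census STRUCTURE bookkeeping of the STPP track (seat pub-omega-stpp-3, gen 28; STRUCTURE row B5, §2 C10), not progress on `ω`: a `(2,2,2)^k` family in a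
small group certifies no matrix-multiplication bound of interest.

The all-type laws give `(2,2,2)^k` in every abelian group of even order `≥ 2N` (`N = 290, 321, 401` for `k = 14, 15, 16`) by ENG2's fat lift on the quotient
by an element of order `2` (`…T2K14N290Law`, `…T2K15N321Law`, `…T2K16N401Law`).  The window laws' ORDER corollaries
(`exists_isSTPP_122pow14_of_card_ge_284_of_card_ne_289`, `exists_isSTPP_122pow15_of_card_ge_316_of_card_ne_320`,
`exists_isSTPP_122pow16_of_card_ge_324_of_card_ne`) push this down to twice the cyclic ray start, excluding only twice the exception orders:

* `exists_isSTPP_222pow14_of_even_card_ge_568_of_ne` — even order `≥ 568`, `≠ 578` ⇒ `(2,2,2)¹⁴`;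
* `exists_isSTPP_222pow15_of_even_card_ge_632_of_ne` — even order `≥ 632`, `≠ 640` ⇒ `(2,2,2)¹⁵`;
* `exists_isSTPP_222pow16_of_even_card_ge_648_of_ne` — even order `≥ 648`, `∉ {676, 704}` ⇒ `(2,2,2)¹⁶`.

No onset and no `iff` is claimed; the excluded orders are twice the orders of the window laws' exception types (`ℤ/17²`; `ℤ/8²×ℤ/5`, `ℤ/5×(ℤ/2)⁶`; `ℤ/13²×ℤ/2`,
`ℤ/11×(ℤ/2)⁵`), about which nothing is claimed.

References: H. Cohn, R. Kleinberg, B. Szegedy, C. Umans, FOCS 2005 (arXiv:math/0511460), Def. 5.1.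
-/

open Literature.Computability.AlgebraicComplexity Finset

namespace Summit.MatrixMultiplication.OmegaCensus

universe u

/-- **`(2,2,2)¹⁴` in every finite abelian group of even order `≥ 568` and `≠ 578`** (quotient by an order-2 subgroup has order `≥ 284`, `≠ 289`; window law
`k = 14` + ENG2's fat lift). [cite: CohnKleinbergSzegedyUmans2005, Def. 5.1] -/
theorem exists_isSTPP_222pow14_of_even_card_ge_568_of_ne {G : Type u} [AddCommGroup G] [Finite G] (heven : Even (Nat.card G))
    (hG : 568 ≤ Nat.card G) (hne : Nat.card G ≠ 578) :
    ∃ A B C : Fin 14 → Finset G, IsSTPP A B C ∧ ∀ i, (A i).card = 2 ∧ (B i).card = 2 ∧ (C i).card = 2 := by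
  classical
  haveI := Fintype.ofFinite G
  obtain ⟨H, h2, hcard⟩ := exists_addSubgroup_card_two (G := G) heven
  exact exists_isSTPP_222_of_122_of_surjective (QuotientAddGroup.mk' H) (QuotientAddGroup.mk'_surjective H)
    (by rw [card_filter_quotient_mk'_eq_zero, h2])
    (exists_isSTPP_122pow14_of_card_ge_284_of_card_ne_289 (G := G ⧸ H) (by omega) (by omega))

/-- **`(2,2,2)¹⁵` in every finite abelian group of even order `≥ 632` and `≠ 640`** (quotient by an order-2 subgroup has order `≥ 316`, `≠ 320`; window law
`k = 15` + ENG2's fat lift). [cite: CohnKleinbergSzegedyUmans2005, Def. 5.1] -/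
theorem exists_isSTPP_222pow15_of_even_card_ge_632_of_ne {G : Type u} [AddCommGroup G] [Finite G] (heven : Even (Nat.card G))
    (hG : 632 ≤ Nat.card G) (hne : Nat.card G ≠ 640) :
    ∃ A B C : Fin 15 → Finset G, IsSTPP A B C ∧ ∀ i, (A i).card = 2 ∧ (B i).card = 2 ∧ (C i).card = 2 := by
  classical
  haveI := Fintype.ofFinite G
  obtain ⟨H, h2, hcard⟩ := exists_addSubgroup_card_two (G := G) heven
  exact exists_isSTPP_222_of_122_of_surjective (QuotientAddGroup.mk' H) (QuotientAddGroup.mk'_surjective H)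
    (by rw [card_filter_quotient_mk'_eq_zero, h2])
    (exists_isSTPP_122pow15_of_card_ge_316_of_card_ne_320 (G := G ⧸ H) (by omega) (by omega))

/-- **`(2,2,2)¹⁶` in every finite abelian group of even order `≥ 648` whose order is neither `676` nor `704`** (quotient by an order-2 subgroup has order `≥ 324`,
`∉ {338, 352}`; window law `k = 16` + ENG2's fat lift). [cite: CohnKleinbergSzegedyUmans2005, Def. 5.1] -/
theorem exists_isSTPP_222pow16_of_even_card_ge_648_of_ne {G : Type u} [AddCommGroup G] [Finite G] (heven : Even (Nat.card G))
    (hG : 648 ≤ Nat.card G) (h1 : Nat.card G ≠ 676) (h2' : Nat.card G ≠ 704) :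
    ∃ A B C : Fin 16 → Finset G, IsSTPP A B C ∧ ∀ i, (A i).card = 2 ∧ (B i).card = 2 ∧ (C i).card = 2 := by
  classical
  haveI := Fintype.ofFinite G
  obtain ⟨H, h2, hcard⟩ := exists_addSubgroup_card_two (G := G) heven
  exact exists_isSTPP_222_of_122_of_surjective (QuotientAddGroup.mk' H) (QuotientAddGroup.mk'_surjective H)
    (by rw [card_filter_quotient_mk'_eq_zero, h2])
    (exists_isSTPP_122pow16_of_card_ge_324_of_card_ne (G := G ⧸ H) (by omega) (by omega) (by omega))

end Summit.MatrixMultiplication.OmegaCensus
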